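import Mathlib
import HarnessLib

/-!
# LINE (A) `product_plus_one` — the FAST-KNEE SHELL under (NEG1″): «E5′ ⟸ the two defect sets Q_L, Q_R are intervals» (memo §29)

Owner memo `pub/ideators/val-idea-25/NOTE-idea25g3-18050-LINEA-AB-reduction.md` §29 (val-idea-25 g5; file sha16 30c9a7cee56b5f10, ll. 1153–1189):
ONE fast knee `β` of rate `κ` against a background `S > 0` with `θ²S = S₂ > 0` (27.1: poles and slow knees make `S` convex in `u = log x`) on a window
component `J = (a,b)`.  In the θ-currency of ✓ `…FastKneeShell` (`θS = S₁`, `θS₁ = S₂`, `G♭ = S₁ + κ·T·S`, `T = (q−1)/(q+1)`, `q = a₀x^κ`, band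
`Y = {S₁² < κ²S²}`, defect `N_κ = κ²S² − (3S₁² − 2SS₂)`; the zeros of `F = S − c·q/(1+q)²` are the level-`c` points of `E = S(1+q)²/q` whose critical points
are the zeros of `G♭`, i.e. the solutions of `Λ = a₀`, `Λ` antitone off `{N_κ < 0}` and monotone on it):

* ★ `fastKneeShell_no_five_zeros_of_neg1` — if `Y` is order-connected, `S₂ > 0` on `J`, the two defect sets
  `Q_L = {x ∈ Y : S₁ < 0, N_κ < 0}` (descending flank) and `Q_R = {x ∈ Y : S₁ > 0, N_κ < 0}` (ascending flank) are EACH order-connected — the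
  owner's located leaf (NEG1″), 320/320 — and `G♭` vanishes on no sub-interval, then `F` has no five zeros on `J` (E5′: at most four).
  The new point over ✓ `fastKneeShell_no_five_zeros` ((L4′): the whole of `{N_κ < 0} ∩ Y` one interval): ONE-SIDEDNESS (memo 29.2 (c)) in
  `Λ`-currency — at a zero of `G♭`, `sign S₁ = −sign T = −sign(q − 1)`, while `S₁` increases (`S₂ > 0`) and `q` increases; so ALL zeros of `G♭` lie
  on ONE flank (`{S₁ ≤ 0}` or `{S₁ ≥ 0}`), where `{N_κ < 0}` is the single interval `Q_L` (resp. `Q_R`): three monotone blocks of `Λ`, four Rolle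
  zeros put two in one block ⇒ an interval of zeros.  With `S₂ > 0` the core lemma 29.2 (b) is automatic (`N_κ < 0 ⇒ 3S₁² > κ²S²`), so the slope
  band `κ/√3 < |y| < κ` of the memo's `Q_±` is implied and not typed.

Honest framing: a conditional real-analysis shell; (NEG1″) and the band-connectedness are LOCATED, not proved; nothing here proves `WronskianBudgetK3` /
`OneChangeFloorK3` / the stubs / 18050 / `MatrixDescartes`; `VP ≠ VNP` is NOT proved.  No definitions, no named facts; Mathlib only.
-/

set_option linter.dupNamespace false

namespace Summit.ValiantsHypothesis.ValiantsHypothesis.Theorems.LacunarySymmetroidMatrixDescartes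

namespace ProductPlusOne

open Set
open scoped Topology

/-- ★ **THE FAST-KNEE SHELL UNDER (NEG1″).**  θ-data `HasDerivAt S (S₁ x / x) x`, `HasDerivAt S₁ (S₂ x / x) x`, `S > 0` and `S₂ > 0` on `J = (a,b)`,
`0 ≤ a`; fast knee of rate `n+1`, centre parameter `a₀ > 0`, any weight `c`; `G♭ := S₁ + (n+1)·T·S`, `T = (a₀x^{n+1} − 1)/(a₀x^{n+1} + 1)`,
`Y := {x ∈ J : S₁² < (n+1)²S²}`, `N := (n+1)²S² − (3S₁² − 2S·S₂)`.  If `Y`, `Q_L := {x ∈ Y : S₁ < 0, N < 0}` and `Q_R := {x ∈ Y : S₁ > 0, N < 0}` are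
order-connected and `G♭` vanishes on no sub-interval of `J`, then `F := S − c·a₀x^{n+1}/(1 + a₀x^{n+1})²` does not vanish at five points of `J`.
[this file's theorem] -/
theorem fastKneeShell_no_five_zeros_of_neg1 (n : ℕ) {a b a₀ c : ℝ} {S S₁ S₂ : ℝ → ℝ} (ha : 0 ≤ a) (ha₀ : 0 < a₀)
    (hS : ∀ x ∈ Ioo a b, HasDerivAt S (S₁ x / x) x) (hS₁ : ∀ x ∈ Ioo a b, HasDerivAt S₁ (S₂ x / x) x)
    (hSpos : ∀ x ∈ Ioo a b, 0 < S x) (hS₂pos : ∀ x ∈ Ioo a b, 0 < S₂ x)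
    (hY : ∀ t₁ ∈ Ioo a b, ∀ t₂ ∈ Ioo a b, ∀ t₃ ∈ Ioo a b, t₁ < t₂ → t₂ < t₃ →
      S₁ t₁ ^ 2 < ((n : ℝ) + 1) ^ 2 * S t₁ ^ 2 → S₁ t₃ ^ 2 < ((n : ℝ) + 1) ^ 2 * S t₃ ^ 2 →
      S₁ t₂ ^ 2 < ((n : ℝ) + 1) ^ 2 * S t₂ ^ 2)
    (hQL : ∀ t₁ ∈ Ioo a b, ∀ t₂ ∈ Ioo a b, ∀ t₃ ∈ Ioo a b, t₁ < t₂ → t₂ < t₃ →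
      (S₁ t₁ ^ 2 < ((n : ℝ) + 1) ^ 2 * S t₁ ^ 2 ∧ S₁ t₁ < 0 ∧ ((n : ℝ) + 1) ^ 2 * S t₁ ^ 2 < 3 * S₁ t₁ ^ 2 - 2 * S t₁ * S₂ t₁) →
      (S₁ t₃ ^ 2 < ((n : ℝ) + 1) ^ 2 * S t₃ ^ 2 ∧ S₁ t₃ < 0 ∧ ((n : ℝ) + 1) ^ 2 * S t₃ ^ 2 < 3 * S₁ t₃ ^ 2 - 2 * S t₃ * S₂ t₃) →
      ((n : ℝ) + 1) ^ 2 * S t₂ ^ 2 < 3 * S₁ t₂ ^ 2 - 2 * S t₂ * S₂ t₂)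
    (hQR : ∀ t₁ ∈ Ioo a b, ∀ t₂ ∈ Ioo a b, ∀ t₃ ∈ Ioo a b, t₁ < t₂ → t₂ < t₃ →
      (S₁ t₁ ^ 2 < ((n : ℝ) + 1) ^ 2 * S t₁ ^ 2 ∧ 0 < S₁ t₁ ∧ ((n : ℝ) + 1) ^ 2 * S t₁ ^ 2 < 3 * S₁ t₁ ^ 2 - 2 * S t₁ * S₂ t₁) →
      (S₁ t₃ ^ 2 < ((n : ℝ) + 1) ^ 2 * S t₃ ^ 2 ∧ 0 < S₁ t₃ ∧ ((n : ℝ) + 1) ^ 2 * S t₃ ^ 2 < 3 * S₁ t₃ ^ 2 - 2 * S t₃ * S₂ t₃) →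
      ((n : ℝ) + 1) ^ 2 * S t₂ ^ 2 < 3 * S₁ t₂ ^ 2 - 2 * S t₂ * S₂ t₂)
    (hfin : ∀ c' d', a ≤ c' → c' < d' → d' ≤ b → ∃ x ∈ Ioo c' d',
      S₁ x + ((n : ℝ) + 1) * ((a₀ * x ^ (n + 1) - 1) / (a₀ * x ^ (n + 1) + 1)) * S x ≠ 0)
    {x₁ x₂ x₃ x₄ x₅ : ℝ} (h₁ : x₁ ∈ Ioo a b) (h₅ : x₅ ∈ Ioo a b)
    (h12 : x₁ < x₂) (h23 : x₂ < x₃) (h34 : x₃ < x₄) (h45 : x₄ < x₅)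
    (hz : ∀ x ∈ ({x₁, x₂, x₃, x₄, x₅} : Set ℝ), S x - c * (a₀ * x ^ (n + 1)) / (1 + a₀ * x ^ (n + 1)) ^ 2 = 0) : False := by
  set I : Set ℝ := Ioo a b with hI
  have hIc : I.OrdConnected := ordConnected_Ioo
  set k : ℝ := (n : ℝ) + 1 with hk
  have hk0 : 0 < k := by positivity
  have hxpos : ∀ x ∈ I, 0 < x := fun x hx => ha.trans_lt hx.1
  set q : ℝ → ℝ := fun x => a₀ * x ^ (n + 1) with hqdef
  have hqpos : ∀ x ∈ I, 0 < q x := fun x hx => mul_pos ha₀ (pow_pos (hxpos x hx) _)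
  have hq : ∀ x ∈ I, HasDerivAt q (k * q x / x) x := by
    intro x hx
    have hx0 : x ≠ 0 := (hxpos x hx).ne'
    have h := (hasDerivAt_pow (n + 1) x).const_mul a₀; refine h.congr_deriv ?_; simp only [hqdef, hk]
    push_cast
    rw [pow_succ]; field_simp
  set T : ℝ → ℝ := fun x => (q x - 1) / (q x + 1) with hTdef
  set Gf : ℝ → ℝ := fun x => S₁ x + k * T x * S x with hGfdef
  set hf : ℝ → ℝ := fun x => (1 + q x) ^ 2 / q x with hhfdef
  have hhfpos : ∀ x ∈ I, 0 < hf x := fun x hx => div_pos (by nlinarith [hqpos x hx]) (hqpos x hx)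
  have hhf : ∀ x ∈ I, HasDerivAt hf (k * T x * hf x / x) x := by
    intro x hx; have hx0 : x ≠ 0 := (hxpos x hx).ne'; have hq0 : q x ≠ 0 := (hqpos x hx).ne'
    have hq1 : q x + 1 ≠ 0 := by nlinarith [hqpos x hx]
    have hnum : HasDerivAt (fun x => (1 + q x) ^ 2) (2 * (1 + q x) * (k * q x / x)) x := by
      have := ((hq x hx).const_add 1).pow 2
      refine this.congr_deriv ?_; push_cast; ring
    refine ((hnum.div (hq x hx) hq0)).congr_deriv ?_; simp only [hhfdef, hTdef]; field_simp; ring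
  set E : ℝ → ℝ := fun x => S x * hf x with hEdef
  have hE : ∀ x ∈ I, HasDerivAt E (Gf x * hf x / x) x := by
    intro x hx
    have hx0 : x ≠ 0 := (hxpos x hx).ne'
    refine ((hS x hx).mul (hhf x hx)).congr_deriv ?_; simp only [hGfdef]; field_simp
  have hElevel : ∀ x ∈ I, S x - c * (a₀ * x ^ (n + 1)) / (1 + a₀ * x ^ (n + 1)) ^ 2 = 0 → E x = c := by
    intro x hx hFx
    have hq0 : q x ≠ 0 := (hqpos x hx).ne'
    have hq1 : (1 + q x) ≠ 0 := by nlinarith [hqpos x hx]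
    have : S x = c * q x / (1 + q x) ^ 2 := by have := hFx; simp only [hqdef] at this ⊢; linarith
    simp only [hEdef, hhfdef, this]; field_simp
  have h₂ : x₂ ∈ I := ⟨h₁.1.trans h12, h23.trans (h34.trans (h45.trans h₅.2))⟩
  have h₃ : x₃ ∈ I := ⟨h₂.1.trans h23, h34.trans (h45.trans h₅.2)⟩
  have h₄ : x₄ ∈ I := ⟨h₃.1.trans h34, h45.trans h₅.2⟩
  have hEeq : ∀ x ∈ ({x₁, x₂, x₃, x₄, x₅} : Set ℝ), x ∈ I → E x = c := fun x hx hxI => hElevel x hxI (hz x hx)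
  have rolle : ∀ {p r : ℝ}, p ∈ I → r ∈ I → p < r → E p = c → E r = c → ∃ t ∈ Ioo p r, Gf t = 0 := by
    intro p r hp hr hpr hEp hEr
    have hsub : Icc p r ⊆ I := hIc.out hp hr
    have hcont : ContinuousOn E (Icc p r) := fun t ht => (hE t (hsub ht)).continuousAt.continuousWithinAt
    obtain ⟨t, ht, ht'⟩ := exists_hasDerivAt_eq_zero hpr hcont (by rw [hEp, hEr])
      (fun t ht => hE t (hsub (Ioo_subset_Icc_self ht)))
    have htI : t ∈ I := hsub (Ioo_subset_Icc_self ht)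
    refine ⟨t, ht, ?_⟩
    have hne : hf t / t ≠ 0 := div_ne_zero (hhfpos t htI).ne' (hxpos t htI).ne'
    have : Gf t * (hf t / t) = 0 := by rw [← mul_div_assoc]; exact ht'
    exact (mul_eq_zero.1 this).resolve_right hne
  obtain ⟨c₁, hc₁, hg₁⟩ := rolle h₁ h₂ h12 (hEeq _ (by simp) h₁) (hEeq _ (by simp) h₂); obtain ⟨c₂, hc₂, hg₂⟩ := rolle h₂ h₃ h23 (hEeq _ (by simp) h₂) (hEeq _ (by simp) h₃)
  obtain ⟨c₃, hc₃, hg₃⟩ := rolle h₃ h₄ h34 (hEeq _ (by simp) h₃) (hEeq _ (by simp) h₄); obtain ⟨c₄, hc₄, hg₄⟩ := rolle h₄ h₅ h45 (hEeq _ (by simp) h₄) (hEeq _ (by simp) h₅)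
  have hc₁I : c₁ ∈ I := ⟨h₁.1.trans hc₁.1, hc₁.2.trans h₂.2⟩
  have hc₂I : c₂ ∈ I := ⟨h₂.1.trans hc₂.1, hc₂.2.trans h₃.2⟩
  have hc₃I : c₃ ∈ I := ⟨h₃.1.trans hc₃.1, hc₃.2.trans h₄.2⟩
  have hc₄I : c₄ ∈ I := ⟨h₄.1.trans hc₄.1, hc₄.2.trans h₅.2⟩
  have hc12 : c₁ < c₂ := hc₁.2.trans hc₂.1; have hc23 : c₂ < c₃ := hc₂.2.trans hc₃.1; have hc34 : c₃ < c₄ := hc₃.2.trans hc₄.1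
  set Y : Set ℝ := {x | x ∈ I ∧ S₁ x ^ 2 < k ^ 2 * S x ^ 2} with hYdef
  set Bs : Set ℝ := {x | x ∈ Y ∧ k ^ 2 * S x ^ 2 < 3 * S₁ x ^ 2 - 2 * S x * S₂ x} with hBsdef
  have hY_sub : Y ⊆ I := fun x hx => hx.1; have hBs_sub : Bs ⊆ Y := fun x hx => hx.1
  have hT_sq : ∀ x ∈ I, T x ^ 2 < 1 := by
    intro x hx; have hq' := hqpos x hx
    have h1 : q x + 1 ≠ 0 := by linarith
    rw [hTdef]; rw [div_pow, div_lt_one (by positivity)]; nlinarith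
  have hzero_Y : ∀ x ∈ I, Gf x = 0 → x ∈ Y := by
    intro x hx hG; refine ⟨hx, ?_⟩; have hS' := hSpos x hx
    have : S₁ x = -(k * T x * S x) := by simp only [hGfdef] at hG; linarith
    rw [this]; have hT := hT_sq x hx
    have : (-(k * T x * S x)) ^ 2 = T x ^ 2 * (k ^ 2 * S x ^ 2) := by ring
    rw [this]
    have hkS : 0 < k ^ 2 * S x ^ 2 := by positivity
    calc T x ^ 2 * (k ^ 2 * S x ^ 2) < 1 * (k ^ 2 * S x ^ 2) := by
          exact mul_lt_mul_of_pos_right hT hkS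
      _ = k ^ 2 * S x ^ 2 := one_mul _
  have hband : ∀ x ∈ Y, 0 < k * S x + S₁ x ∧ 0 < k * S x - S₁ x := by
    intro x hx; have hS' := hSpos x hx.1
    have hkS : 0 < k * S x := mul_pos hk0 hS'
    have h2 : S₁ x ^ 2 < (k * S x) ^ 2 := by rw [mul_pow]; exact hx.2
    have habs : |S₁ x| < k * S x := abs_lt_of_sq_lt_sq h2 hkS.le
    constructor <;> [linarith [(abs_lt.1 habs).1]; linarith [(abs_lt.1 habs).2]]
  set DEN : ℝ → ℝ := fun x => (k * S x + S₁ x) * x ^ (n + 1) with hDENdef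
  set NUM : ℝ → ℝ := fun x => k * S x - S₁ x with hNUMdef
  set Λ : ℝ → ℝ := fun x => NUM x / DEN x with hΛdef
  have hDENpos : ∀ x ∈ Y, 0 < DEN x := fun x hx => mul_pos (hband x hx).1 (pow_pos (hxpos x hx.1) _)
  have hGf_iff : ∀ x ∈ Y, Gf x = 0 ↔ Λ x = a₀ := by
    intro x hx; have hD := (hDENpos x hx).ne'
    have hq1 : q x + 1 ≠ 0 := by linarith [hqpos x hx.1]
    have key : Gf x * (q x + 1) = a₀ * DEN x - NUM x := by
      have hq1' : a₀ * x ^ (n + 1) + 1 ≠ 0 := by simpa [hqdef] using hq1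
      have e1 : Gf x * (q x + 1) = S₁ x * (a₀ * x ^ (n + 1) + 1) + k * (a₀ * x ^ (n + 1) - 1) * S x := by
        simp only [hGfdef, hTdef, hqdef]; rw [add_mul, mul_assoc k, mul_comm (_ / _) (S x), ← mul_assoc, mul_assoc (k * S x), div_mul_cancel₀ _ hq1']; ring
      rw [e1]; simp only [hNUMdef, hDENdef]; ring
    rw [hΛdef]; rw [div_eq_iff hD]; constructor
    · intro h
      have : a₀ * DEN x - NUM x = 0 := by rw [← key, h, zero_mul]
      linarith
    · intro h
      have : Gf x * (q x + 1) = 0 := by rw [key, h]; ring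
      exact (mul_eq_zero.1 this).resolve_right hq1
  set Λ' : ℝ → ℝ := fun x => x ^ (n + 1) * (k * ((3 * S₁ x ^ 2 - 2 * S x * S₂ x) - k ^ 2 * S x ^ 2)) / (x * DEN x ^ 2)
    with hΛ'def
  have hΛ : ∀ x ∈ Y, HasDerivAt Λ (Λ' x) x := by
    intro x hx; have hxI := hx.1
    have hx0 : x ≠ 0 := (hxpos x hxI).ne'
    have hD := (hDENpos x hx).ne'
    have hN : HasDerivAt NUM ((k * S₁ x - S₂ x) / x) x := by
      have := ((hS x hxI).const_mul k).sub (hS₁ x hxI)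
      refine this.congr_deriv ?_; field_simp
    have hDd : HasDerivAt DEN (((k * S₁ x + S₂ x) / x) * x ^ (n + 1) + (k * S x + S₁ x) * (((n + 1 : ℕ) : ℝ) * x ^ n)) x := by
      have h1 : HasDerivAt (fun x => k * S x + S₁ x) ((k * S₁ x + S₂ x) / x) x := by
        have := ((hS x hxI).const_mul k).add (hS₁ x hxI)
        refine this.congr_deriv ?_; field_simp
      exact h1.mul (hasDerivAt_pow (n + 1) x)
    refine ((hN.div hDd hD)).congr_deriv ?_; simp only [hΛ'def, hDENdef, hNUMdef, hk]
    push_cast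
    field_simp
    ring
  have hΛ'_sign_pos : ∀ x ∈ Bs, 0 < Λ' x := by
    intro x hx; have hxY := hx.1; have hxp := hxpos x hxY.1; have hD := hDENpos x hxY
    have hcore : 0 < (3 * S₁ x ^ 2 - 2 * S x * S₂ x) - k ^ 2 * S x ^ 2 := by linarith [hx.2]
    simp only [hΛ'def]; positivity
  have hΛ'_sign_nonpos : ∀ x ∈ Y, x ∉ Bs → Λ' x ≤ 0 := by
    intro x hx hnot; have hxp := hxpos x hx.1; have hD := hDENpos x hx
    have hcore : (3 * S₁ x ^ 2 - 2 * S x * S₂ x) - k ^ 2 * S x ^ 2 ≤ 0 := by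
      by_contra h
      push Not at h
      exact hnot ⟨hx, by linarith⟩
    simp only [hΛ'def]; apply div_nonpos_of_nonpos_of_nonneg
    · exact mul_nonpos_of_nonneg_of_nonpos (pow_pos hxp _).le (mul_nonpos_of_nonneg_of_nonpos hk0.le hcore)
    · positivity
  have hS₁mono : StrictMonoOn S₁ I := by
    refine strictMonoOn_of_deriv_pos (convex_Ioo a b) (fun t ht => (hS₁ t ht).continuousAt.continuousWithinAt) ?_; intro t ht; rw [interior_Ioo] at ht
    rw [(hS₁ t ht).deriv]; exact div_pos (hS₂pos t ht) (hxpos t ht)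
  have hqmono : ∀ {s t}, s ∈ I → t ∈ I → s ≤ t → q s ≤ q t := fun hs ht hst =>
    mul_le_mul_of_nonneg_left (pow_le_pow_left₀ (hxpos _ hs).le hst _) ha₀.le
  have hsign_at_zero : ∀ t ∈ I, Gf t = 0 → (S₁ t < 0 → 1 < q t) ∧ (0 < S₁ t → q t < 1) := by
    intro t ht hG; have hS' := hSpos t ht; have hq' := hqpos t ht
    have hq1 : 0 < q t + 1 := by linarith
    have hrel : S₁ t = -(k * T t * S t) := by simp only [hGfdef] at hG; linarith
    have hT : T t = (q t - 1) / (q t + 1) := rfl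
    constructor
    · intro hneg
      have hTpos : 0 < T t := by
        by_contra hcon
        push Not at hcon
        have : 0 ≤ -(k * T t * S t) := by
          have := mul_nonpos_of_nonpos_of_nonneg (mul_nonpos_of_nonneg_of_nonpos hk0.le hcon) hS'.le
          linarith
        linarith
      rw [hT] at hTpos
      have := (div_pos_iff_of_pos_right hq1).1 hTpos
      linarith
    · intro hposS
      have hTneg : T t < 0 := by
        by_contra hcon
        push Not at hcon
        have : -(k * T t * S t) ≤ 0 := by
          have := mul_nonneg (mul_nonneg hk0.le hcon) hS'.le
          linarith
        linarith
      rw [hT, div_lt_iff₀ hq1, zero_mul] at hTneg; linarith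
  have one_side : ∀ {s t}, s ∈ I → t ∈ I → Gf s = 0 → Gf t = 0 → S₁ s < 0 → 0 < S₁ t → False := by
    intro s t hs ht hgs hgt hneg hpos
    have hqs : 1 < q s := (hsign_at_zero s hs hgs).1 hneg
    have hqt : q t < 1 := (hsign_at_zero t ht hgt).2 hpos
    have hts : t < s := by
      by_contra hcon
      push Not at hcon
      have := hqmono hs ht hcon
      linarith
    have := hS₁mono ht hs hts
    linarith
  have hY_conn : ∀ {u v t}, u ∈ Y → v ∈ Y → u ≤ t → t ≤ v → t ∈ Y := by
    intro u v t hu hv hut htv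
    rcases hut.eq_or_lt with rfl | hut'
    · exact hu
    rcases htv.eq_or_lt with rfl | htv'
    · exact hv
    have htI : t ∈ I := hIc.out hu.1 hv.1 ⟨hut, htv⟩
    exact ⟨htI, hY u hu.1 t htI v hv.1 hut' htv' hu.2 hv.2⟩
  have hΛcont : ∀ {Bk : Set ℝ}, Bk ⊆ Y → ContinuousOn Λ Bk := fun hB t ht =>
    (hΛ t (hB ht)).continuousAt.continuousWithinAt
  have hΛwithin : ∀ {Bk : Set ℝ}, Bk ⊆ Y → ∀ t ∈ interior Bk, HasDerivWithinAt Λ (Λ' t) (interior Bk) t :=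
    fun hB t ht => (hΛ t (hB (interior_subset ht))).hasDerivWithinAt
  have hblock : ∀ {Bk : Set ℝ}, Bk ⊆ Y → (MonotoneOn Λ Bk ∨ AntitoneOn Λ Bk) →
      (∀ {u v t}, u ∈ Bk → v ∈ Bk → u ≤ t → t ≤ v → t ∈ Bk) →
      ∀ {u v}, u ∈ Bk → v ∈ Bk → u < v → Gf u = 0 → Gf v = 0 → False := by
    intro Bk hBk hΛB hconn u v hu hv huv hgu hgv
    have hΛu : Λ u = a₀ := (hGf_iff u (hBk hu)).1 hgu
    have hΛv : Λ v = a₀ := (hGf_iff v (hBk hv)).1 hgv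
    obtain ⟨t, ht, hne⟩ := hfin u v (hBk hu).1.1.le huv (hBk hv).1.2.le
    have htB : t ∈ Bk := hconn hu hv ht.1.le ht.2.le
    have hΛt : Λ t = a₀ := by
      rcases hΛB with h | h
      · exact le_antisymm (by simpa [hΛv] using h htB hv ht.2.le) (by simpa [hΛu] using h hu htB ht.1.le)
      · exact le_antisymm (by simpa [hΛu] using h hu htB ht.1.le) (by simpa [hΛv] using h htB hv ht.2.le)
    have : Gf t = 0 := (hGf_iff t (hBk htB)).2 hΛt
    exact hne (by simpa [hGfdef, hTdef, hqdef, hk] using this)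
  have key : ∀ {Ys Q : Set ℝ}, Q ⊆ Ys → Ys ⊆ Y →
      (∀ {u v t}, u ∈ Ys → v ∈ Ys → u ≤ t → t ≤ v → t ∈ Ys) →
      (∀ {u v t}, u ∈ Q → v ∈ Q → u ≤ t → t ≤ v → t ∈ Q) →
      (∀ x ∈ Ys, x ∉ Q → x ∉ Bs) → (Q ⊆ Bs) →
      ∀ {d₁ d₂ d₃ d₄ : ℝ}, d₁ ∈ Ys → d₂ ∈ Ys → d₃ ∈ Ys → d₄ ∈ Ys → d₁ < d₂ → d₂ < d₃ → d₃ < d₄ →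
      Gf d₁ = 0 → Gf d₂ = 0 → Gf d₃ = 0 → Gf d₄ = 0 → False := by
    intro Ys Q hQYs hYsY hYs_conn hQ_conn hoff hQBs d₁ d₂ d₃ d₄ hd₁ hd₂ hd₃ hd₄ hd12 hd23 hd34 hg₁ hg₂ hg₃ hg₄
    have hQY : Q ⊆ Y := fun x hx => hYsY (hQYs hx)
    set A₁ : Set ℝ := {x | x ∈ Ys ∧ ∀ j ∈ Q, x < j} with hA₁def
    set A₂ : Set ℝ := {x | x ∈ Ys ∧ (∃ j ∈ Q, j < x) ∧ x ∉ Q} with hA₂def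
    have hA₁_sub : A₁ ⊆ Y := fun x hx => hYsY hx.1
    have hA₂_sub : A₂ ⊆ Y := fun x hx => hYsY hx.1
    have hcover : ∀ x ∈ Ys, x ∈ A₁ ∨ x ∈ Q ∨ x ∈ A₂ := by
      intro x hx
      by_cases hxB : x ∈ Q
      · exact Or.inr (Or.inl hxB)
      by_cases hlow : ∀ j ∈ Q, x < j
      · exact Or.inl ⟨hx, hlow⟩
      · push Not at hlow
        obtain ⟨j, hj, hjx⟩ := hlow; refine Or.inr (Or.inr ⟨hx, ⟨j, hj, lt_of_le_of_ne hjx ?_⟩, hxB⟩)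
        rintro rfl
        exact hxB hj
    have hA₁_conn : ∀ {u v t}, u ∈ A₁ → v ∈ A₁ → u ≤ t → t ≤ v → t ∈ A₁ := by
      intro u v t hu hv hut htv; exact ⟨hYs_conn hu.1 hv.1 hut htv, fun j hj => lt_of_le_of_lt htv (hv.2 j hj)⟩
    have hA₂_conn : ∀ {u v t}, u ∈ A₂ → v ∈ A₂ → u ≤ t → t ≤ v → t ∈ A₂ := by
      intro u v t hu hv hut htv
      have htY : t ∈ Ys := hYs_conn hu.1 hv.1 hut htv
      obtain ⟨j, hj, hju⟩ := hu.2.1; refine ⟨htY, ⟨j, hj, lt_of_lt_of_le hju hut⟩, fun htB => ?_⟩; exact hu.2.2 (hQ_conn hj htB hju.le hut)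
    have hQ_oc : Q.OrdConnected := ⟨fun u hu v hv t ht => hQ_conn hu hv ht.1 ht.2⟩
    have hA₁_oc : A₁.OrdConnected := ⟨fun u hu v hv t ht => hA₁_conn hu hv ht.1 ht.2⟩
    have hA₂_oc : A₂.OrdConnected := ⟨fun u hu v hv t ht => hA₂_conn hu hv ht.1 ht.2⟩
    have hΛ_Q : MonotoneOn Λ Q :=
      monotoneOn_of_hasDerivWithinAt_nonneg hQ_oc.convex (hΛcont hQY) (hΛwithin hQY)
        (fun t ht => (hΛ'_sign_pos t (hQBs (interior_subset ht))).le)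
    have hΛ_A₁ : AntitoneOn Λ A₁ :=
      antitoneOn_of_hasDerivWithinAt_nonpos hA₁_oc.convex (hΛcont hA₁_sub) (hΛwithin hA₁_sub)
        (fun t ht => by
          have htA := interior_subset (s := A₁) ht; exact hΛ'_sign_nonpos t (hYsY htA.1) (hoff t htA.1 (fun htB => lt_irrefl t (htA.2 t htB))))
    have hΛ_A₂ : AntitoneOn Λ A₂ :=
      antitoneOn_of_hasDerivWithinAt_nonpos hA₂_oc.convex (hΛcont hA₂_sub) (hΛwithin hA₂_sub)
        (fun t ht => by
          have htA := interior_subset (s := A₂) ht; exact hΛ'_sign_nonpos t (hYsY htA.1) (hoff t htA.1 htA.2.2))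
    have hQ_not_A₁ : ∀ {u v}, u ∈ Q → u < v → v ∉ A₁ := fun hu huv hv =>
      lt_irrefl _ ((hv.2 _ hu).trans huv)
    have hA₂_not_A₁ : ∀ {u v}, u ∈ A₂ → u < v → v ∉ A₁ := fun hu huv hv => by
      obtain ⟨j, hj, hju⟩ := hu.2.1; exact lt_irrefl _ (((hv.2 j hj).trans hju).trans huv)
    have hA₂_not_Q : ∀ {u v}, u ∈ A₂ → u < v → v ∉ Q := fun hu huv hv => by
      obtain ⟨j, hj, hju⟩ := hu.2.1; exact hu.2.2 (hQ_conn hj hv hju.le huv.le)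
    have hafter_Q : ∀ {u v}, u ∈ Q → u < v → v ∈ Ys → v ∈ Q ∨ v ∈ A₂ := fun hu huv hvY => by
      rcases hcover _ hvY with hv | hv | hv
      · exact absurd hv (hQ_not_A₁ hu huv)
      · exact Or.inl hv
      · exact Or.inr hv
    have hafter_A₂ : ∀ {u v}, u ∈ A₂ → u < v → v ∈ Ys → v ∈ A₂ := fun hu huv hvY => by
      rcases hcover _ hvY with hv | hv | hv
      · exact absurd hv (hA₂_not_A₁ hu huv)
      · exact absurd hv (hA₂_not_Q hu huv)
      · exact hv
    have same_A₁ := fun {u v : ℝ} (hu : u ∈ A₁) (hv : v ∈ A₁) (huv : u < v) (hgu : Gf u = 0) (hgv : Gf v = 0) =>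
      hblock hA₁_sub (Or.inr hΛ_A₁) (fun hu hv hut htv => hA₁_conn hu hv hut htv) hu hv huv hgu hgv
    have same_Q := fun {u v : ℝ} (hu : u ∈ Q) (hv : v ∈ Q) (huv : u < v) (hgu : Gf u = 0) (hgv : Gf v = 0) =>
      hblock hQY (Or.inl hΛ_Q) (fun hu hv hut htv => hQ_conn hu hv hut htv) hu hv huv hgu hgv
    have same_A₂ := fun {u v : ℝ} (hu : u ∈ A₂) (hv : v ∈ A₂) (huv : u < v) (hgu : Gf u = 0) (hgv : Gf v = 0) =>
      hblock hA₂_sub (Or.inr hΛ_A₂) (fun hu hv hut htv => hA₂_conn hu hv hut htv) hu hv huv hgu hgv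
    have fromQ : ∀ {u v w : ℝ}, u ∈ Q → v ∈ Ys → w ∈ Ys → u < v → v < w →
        Gf u = 0 → Gf v = 0 → Gf w = 0 → False := by
      intro u v w hu hvY hwY huv hvw hgu hgv hgw
      rcases hafter_Q hu huv hvY with hv | hv
      · exact same_Q hu hv huv hgu hgv
      · exact same_A₂ hv (hafter_A₂ hv hvw hwY) hvw hgv hgw
    rcases hcover d₁ hd₁ with k₁ | k₁ | k₁
    · rcases hcover d₂ hd₂ with k₂ | k₂ | k₂
      · exact same_A₁ k₁ k₂ hd12 hg₁ hg₂
      · exact fromQ k₂ hd₃ hd₄ hd23 hd34 hg₂ hg₃ hg₄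
      · exact same_A₂ k₂ (hafter_A₂ k₂ hd23 hd₃) hd23 hg₂ hg₃
    · exact fromQ k₁ hd₂ hd₃ hd12 hd23 hg₁ hg₂ hg₃
    · exact same_A₂ k₁ (hafter_A₂ k₁ hd12 hd₂) hd12 hg₁ hg₂
  have hBs_S₁ne : ∀ x ∈ Bs, S₁ x ≠ 0 := by
    intro x hx h0; have h := hx.2; rw [h0] at h; have hS' := hSpos x hx.1.1; have hS₂' := hS₂pos x hx.1.1; nlinarith
  set QL : Set ℝ := {x | x ∈ Bs ∧ S₁ x < 0} with hQLdef
  set QR : Set ℝ := {x | x ∈ Bs ∧ 0 < S₁ x} with hQRdef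
  set YL : Set ℝ := {x | x ∈ Y ∧ S₁ x ≤ 0} with hYLdef
  set YR : Set ℝ := {x | x ∈ Y ∧ 0 ≤ S₁ x} with hYRdef
  have hc₁Y := hzero_Y c₁ hc₁I hg₁; have hc₂Y := hzero_Y c₂ hc₂I hg₂; have hc₃Y := hzero_Y c₃ hc₃I hg₃; have hc₄Y := hzero_Y c₄ hc₄I hg₄
  have hQL_conn : ∀ {u v t}, u ∈ QL → v ∈ QL → u ≤ t → t ≤ v → t ∈ QL := by
    intro u v t hu hv hut htv
    rcases hut.eq_or_lt with rfl | hut'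
    · exact hu
    rcases htv.eq_or_lt with rfl | htv'
    · exact hv
    have htI : t ∈ I := hIc.out hu.1.1.1 hv.1.1.1 ⟨hut, htv⟩
    have htY : t ∈ Y := hY_conn hu.1.1 hv.1.1 hut htv
    have hN := hQL u hu.1.1.1 t htI v hv.1.1.1 hut' htv' ⟨hu.1.1.2, hu.2, hu.1.2⟩ ⟨hv.1.1.2, hv.2, hv.1.2⟩
    have htS₁ : S₁ t < 0 := lt_trans (hS₁mono htI hv.1.1.1 htv') hv.2
    exact ⟨⟨htY, hN⟩, htS₁⟩
  have hQR_conn : ∀ {u v t}, u ∈ QR → v ∈ QR → u ≤ t → t ≤ v → t ∈ QR := by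
    intro u v t hu hv hut htv
    rcases hut.eq_or_lt with rfl | hut'
    · exact hu
    rcases htv.eq_or_lt with rfl | htv'
    · exact hv
    have htI : t ∈ I := hIc.out hu.1.1.1 hv.1.1.1 ⟨hut, htv⟩
    have htY : t ∈ Y := hY_conn hu.1.1 hv.1.1 hut htv
    have hN := hQR u hu.1.1.1 t htI v hv.1.1.1 hut' htv' ⟨hu.1.1.2, hu.2, hu.1.2⟩ ⟨hv.1.1.2, hv.2, hv.1.2⟩
    have htS₁ : 0 < S₁ t := lt_trans hu.2 (hS₁mono hu.1.1.1 htI hut')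
    exact ⟨⟨htY, hN⟩, htS₁⟩
  have hYL_conn : ∀ {u v t}, u ∈ YL → v ∈ YL → u ≤ t → t ≤ v → t ∈ YL := by
    intro u v t hu hv hut htv; refine ⟨hY_conn hu.1 hv.1 hut htv, ?_⟩
    rcases htv.eq_or_lt with rfl | htv'
    · exact hv.2
    exact le_trans (hS₁mono (hY_conn hu.1 hv.1 hut htv).1 hv.1.1 htv').le hv.2
  have hYR_conn : ∀ {u v t}, u ∈ YR → v ∈ YR → u ≤ t → t ≤ v → t ∈ YR := by
    intro u v t hu hv hut htv; refine ⟨hY_conn hu.1 hv.1 hut htv, ?_⟩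
    rcases hut.eq_or_lt with rfl | hut'
    · exact hu.2
    exact le_trans hu.2 (hS₁mono hu.1.1 (hY_conn hu.1 hv.1 hut htv).1 hut').le
  have hoffL : ∀ x ∈ YL, x ∉ QL → x ∉ Bs := fun x hx hnQ hB =>
    hnQ ⟨hB, lt_of_le_of_ne hx.2 (hBs_S₁ne x hB)⟩
  have hoffR : ∀ x ∈ YR, x ∉ QR → x ∉ Bs := fun x hx hnQ hB =>
    hnQ ⟨hB, lt_of_le_of_ne hx.2 (Ne.symm (hBs_S₁ne x hB))⟩
  by_cases hneg : S₁ c₁ < 0 ∨ S₁ c₂ < 0 ∨ S₁ c₃ < 0 ∨ S₁ c₄ < 0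
  · -- some Rolle zero on the descending flank ⇒ all four have `S₁ ≤ 0`
    have hle : ∀ {t}, t ∈ I → Gf t = 0 → S₁ t ≤ 0 := by
      intro t ht hgt
      by_contra hcon
      push Not at hcon
      rcases hneg with h | h | h | h
      · exact one_side hc₁I ht hg₁ hgt h hcon
      · exact one_side hc₂I ht hg₂ hgt h hcon
      · exact one_side hc₃I ht hg₃ hgt h hcon
      · exact one_side hc₄I ht hg₄ hgt h hcon
    exact key (Ys := YL) (Q := QL) (fun x hx => ⟨hx.1.1, hx.2.le⟩) (fun x hx => hx.1) hYL_conn hQL_conn hoffL (fun x hx => hx.1)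
      ⟨hc₁Y, hle hc₁I hg₁⟩ ⟨hc₂Y, hle hc₂I hg₂⟩ ⟨hc₃Y, hle hc₃I hg₃⟩ ⟨hc₄Y, hle hc₄I hg₄⟩ hc12 hc23 hc34 hg₁ hg₂ hg₃ hg₄
  · push Not at hneg
    obtain ⟨h1, h2, h3, h4⟩ := hneg
    exact key (Ys := YR) (Q := QR) (fun x hx => ⟨hx.1.1, hx.2.le⟩) (fun x hx => hx.1) hYR_conn hQR_conn hoffR (fun x hx => hx.1)
      ⟨hc₁Y, h1⟩ ⟨hc₂Y, h2⟩ ⟨hc₃Y, h3⟩ ⟨hc₄Y, h4⟩ hc12 hc23 hc34 hg₁ hg₂ hg₃ hg₄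

end ProductPlusOne

end Summit.ValiantsHypothesis.ValiantsHypothesis.Theorems.LacunarySymmetroidMatrixDescartes
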